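import Literature.MathematicalPhysics.KineticTheory.CollisionTubePullbackPathwise
import Literature.MathematicalPhysics.KineticTheory.CollisionTubePullbackPacking
import HarnessLib

/-!
# `stub_cylinderPullbackOfResiduals`: the cylinder pull-back in probability from its three residual
# concentrations (helper stub, S2 glue of the crux line `even-rung-mean-variance`,
# `JParityClosure.EvenStressEnskog`, stmt-AtomisticToContinuum-13079)

In the crux's quantifier frame: if `((N+1)κ)⁻¹ · continuityCorrection`, `((N+1)κ)⁻¹ · shortFlightDeficit`
and `ε_N/(N+1) · threeBodyCollisionSum` of the orbit (Literature `CollisionTubePullbackDefs`) tend to `0`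
in `localGibbsLaw`-probability (`N → ∞` after `κ → 0`, at fixed `r, L`), then so does
`collisionSum … (evenMarkTrunc k l L) r z − tubeTimeStat … (evenMarkTrunc k l L) r r 1 κ z` (S2\*).
Proof: the pathwise pull-back `cylinderPullback_pathwise` on the good set (full measure,
`localGibbsLaw_goodCompl`), the deterministic late-pair bound `residual_latePairs` (packing), sup
constants of `χ` on `[0, τ] × 𝕋³` and of `g` on `[0, ∞)` by compactness, `C_Ψ = 2L`
(`abs_evenMarkTrunc_le`), and a union bound over four events.
-/

noncomputable section

open scoped BigOperators Classical InnerProductSpace ENNReal Topology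
open Set MeasureTheory Filter Function

namespace Summit.AtomisticToContinuum.HydrodynamicLimit.Theorems.EvenStressEnskog

open Literature.Analysis.FluidPDE Literature.MathematicalPhysics.KineticTheory


/-- Elementary: `x · η/(4(x+1)) ≤ η/4` for `x, η ≥ 0`. [folklore] -/
theorem mul_eta_div_le {x η : ℝ} (hx : 0 ≤ x) (hη : 0 ≤ η) : x * (η / (4 * (x + 1))) ≤ η / 4 := by
  rw [show x * (η / (4 * (x + 1))) = η / 4 * (x / (x + 1)) by field_simp]
  exact mul_le_of_le_one_right (by positivity) ((div_le_one (by linarith)).2 (by linarith))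

/-- **S2\* from the pathwise pull-back and the three residual concentrations** (registered helper stub
`stub_cylinderPullbackOfResiduals`).  If, in the crux's frame,
`((N+1)κ)⁻¹ R_cont`, `((N+1)κ)⁻¹ R_short` and `ε/(N+1) · N₃` tend to `0` in `localGibbsLaw`-probability
(`N → ∞` after `κ → 0`, at fixed `r, L`), then so does `K_N[χ g Ξ_L] − ∫₀^τ A_t(Φ_t ·) dt` for the
truncated even marks `Ξ_L = evenMarkTrunc k l L` — by the pathwise pull-back
`cylinderPullback_pathwise` on the good set (of full measure, `localGibbsLaw_goodCompl`), the
deterministic late-pair bound `residual_latePairs` (packing) and a union bound; the sup constants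
`C_χ, C_g` exist by compactness and `C_Ψ = 2L` (`abs_evenMarkTrunc_le`). [folklore] -/
theorem stub_cylinderPullbackOfResiduals :
    (∃ η₀ : ℝ, 0 < η₀ ∧ ∀ (a₀ θ₀ : T3 → ℝ) (u₀ : T3 → V3), Continuous a₀ → Continuous θ₀ → Continuous u₀ → (∀ x, 0 < a₀ x) → (∀ x, 0 < θ₀ x) → ∃ σ₀ : ℝ, 0 < σ₀ ∧ ∀ σ : ℝ, 0 < σ → σ < σ₀ → ∀ Φ : (N : ℕ) → HardSphereFlow (Torus.geometry (Fin 3)) (hsDiameter σ N) (N + 1), ∀ τ : ℝ, 0 < τ → ∀ χ : ℝ × UnitAddTorus (Fin 3) → ℝ, Continuous χ → ∀ g : ℝ → ℝ, Continuous g → (∀ a, η₀ ≤ a → g a = 0) → ∀ η δ : ℝ, 0 < η → 0 < δ → ∃ r₀ : ℝ, 0 < r₀ ∧ ∀ r : ℝ, 0 < r → r < r₀ → ∀ L : ℝ, 1 ≤ L → ∃ κ₀ : ℝ, 0 < κ₀ ∧ ∀ κ : ℝ, 0 < κ → κ < κ₀ → ∃ N₀ : ℕ, ∀ N : ℕ,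 N₀ ≤ N → ∀ k l : Fin 3, localGibbsLaw σ a₀ u₀ θ₀ N (Φ N) {z | η < ((N + 1 : ℝ) * κ)⁻¹ * continuityCorrection σ N (Φ N) τ χ g (evenMarkTrunc k l L) r κ z} ≤ ENNReal.ofReal δ) → (∃ η₀ : ℝ, 0 < η₀ ∧ ∀ (a₀ θ₀ : T3 → ℝ) (u₀ : T3 → V3), Continuous a₀ → Continuous θ₀ → Continuous u₀ → (∀ x, 0 < a₀ x) → (∀ x, 0 < θ₀ x) → ∃ σ₀ : ℝ, 0 < σ₀ ∧ ∀ σ : ℝ, 0 < σ → σ < σ₀ → ∀ Φ : (N : ℕ) → HardSphereFlow (Torus.geometry (Fin 3)) (hsDiameter σ N) (N + 1), ∀ τ : ℝ, 0 < τ → ∀ χ : ℝ × UnitAddTorus (Fin 3) → ℝ, Continuous χ → ∀ g : ℝ → ℝ, Continuous g → (∀ a, η₀ ≤ a → g a = 0) → ∀ η δ : ℝ, 0 < η → 0 < δ → ∃ r₀ : ℝ, 0 < r₀ ∧ ∀ r : ℝ, 0 < r → r < r₀ → ∀ L : ℝ, 1 ≤ L → ∃ κ₀ : ℝ, 0 <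 κ₀ ∧ ∀ κ : ℝ, 0 < κ → κ < κ₀ → ∃ N₀ : ℕ, ∀ N : ℕ, N₀ ≤ N → ∀ k l : Fin 3, localGibbsLaw σ a₀ u₀ θ₀ N (Φ N) {z | η < ((N + 1 : ℝ) * κ)⁻¹ * shortFlightDeficit σ N (Φ N) τ (evenMarkTrunc k l L) κ z} ≤ ENNReal.ofReal δ) → (∀ (a₀ θ₀ : T3 → ℝ) (u₀ : T3 → V3), Continuous a₀ → Continuous θ₀ → Continuous u₀ → (∀ x, 0 < a₀ x) → (∀ x, 0 < θ₀ x) → ∃ σ₀ : ℝ, 0 < σ₀ ∧ ∀ σ : ℝ, 0 < σ → σ < σ₀ → ∀ Φ : (N : ℕ) → HardSphereFlow (Torus.geometry (Fin 3)) (hsDiameter σ N) (N + 1), ∀ τ : ℝ, 0 < τ → ∀ η δ : ℝ, 0 < η → 0 < δ → ∀ L : ℝ, 1 ≤ L → ∃ κ₀ : ℝ, 0 < κ₀ ∧ ∀ κ : ℝ, 0 < κ → κ < κ₀ → ∃ N₀ : ℕ, ∀ N : ℕ, N₀ ≤ N → localGibbsLaw σ a₀ u₀ θ₀ N (Φ N)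 {z | η < hsDiameter σ N / (N + 1 : ℝ) * threeBodyCollisionSum σ N (Φ N) τ L κ z} ≤ ENNReal.ofReal δ) → ∃ η₀ : ℝ, 0 < η₀ ∧ ∀ (a₀ θ₀ : T3 → ℝ) (u₀ : T3 → V3), Continuous a₀ → Continuous θ₀ → Continuous u₀ → (∀ x, 0 < a₀ x) → (∀ x, 0 < θ₀ x) → ∃ σ₀ : ℝ, 0 < σ₀ ∧ ∀ σ : ℝ, 0 < σ → σ < σ₀ → ∀ Φ : (N : ℕ) → HardSphereFlow (Torus.geometry (Fin 3)) (hsDiameter σ N) (N + 1), ∀ τ : ℝ, 0 < τ → ∀ χ : ℝ × UnitAddTorus (Fin 3) → ℝ, Continuous χ → ∀ g : ℝ → ℝ, Continuous g → (∀ a, η₀ ≤ a → g a = 0) → ∀ η δ : ℝ, 0 < η → 0 < δ → ∃ r₀ : ℝ, 0 < r₀ ∧ ∀ r : ℝ, 0 < r → r < r₀ → ∀ L : ℝ, 1 ≤ L → ∃ κ₀ : ℝ, 0 < κ₀ ∧ ∀ κ : ℝ, 0 < κ → κ < κ₀ → ∃ N₀ : ℕ, ∀ N : ℕ, N₀ ≤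 N → ∀ k l : Fin 3, localGibbsLaw σ a₀ u₀ θ₀ N (Φ N) {z | η < |collisionSum σ N (Φ N) τ χ g (evenMarkTrunc k l L) r z - tubeTimeStat σ N (Φ N) τ χ g (evenMarkTrunc k l L) r r 1 κ z|} ≤ ENNReal.ofReal δ := by
  intro h1 h2 h3
  obtain ⟨η₁, hη₁, H1⟩ := h1
  obtain ⟨η₂, hη₂, H2⟩ := h2
  refine ⟨min η₁ η₂, lt_min hη₁ hη₂, ?_⟩
  intro a₀ θ₀ u₀ ha hθ hu ha0 hθ0
  obtain ⟨σ₁, hσ₁, H1⟩ := H1 a₀ θ₀ u₀ ha hθ hu ha0 hθ0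
  obtain ⟨σ₂, hσ₂, H2⟩ := H2 a₀ θ₀ u₀ ha hθ hu ha0 hθ0
  obtain ⟨σ₃, hσ₃, H3⟩ := h3 a₀ θ₀ u₀ ha hθ hu ha0 hθ0
  obtain ⟨σ₄, hσ₄, H4⟩ := residual_latePairs a₀ θ₀ u₀ ha hθ hu ha0 hθ0
  refine ⟨min (min (min σ₁ σ₂) (min σ₃ σ₄)) (1 / 4),
    lt_min (lt_min (lt_min hσ₁ hσ₂) (lt_min hσ₃ hσ₄)) (by norm_num), ?_⟩
  intro σ hσ hσlt Φ τ hτ χ hχ g hg hg0 η δ hη hδ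
  have hσ4 : σ < 1 / 4 := lt_of_lt_of_le hσlt (min_le_right _ _)
  have hσ' : σ < min (min σ₁ σ₂) (min σ₃ σ₄) := lt_of_lt_of_le hσlt (min_le_left _ _)
  have hσ₁' : σ < σ₁ := lt_of_lt_of_le hσ' ((min_le_left _ _).trans (min_le_left _ _))
  have hσ₂' : σ < σ₂ := lt_of_lt_of_le hσ' ((min_le_left _ _).trans (min_le_right _ _))
  have hσ₃' : σ < σ₃ := lt_of_lt_of_le hσ' ((min_le_right _ _).trans (min_le_left _ _))
  have hσ₄' : σ < σ₄ := lt_of_lt_of_le hσ' ((min_le_right _ _).trans (min_le_right _ _))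
  have hg1 : ∀ a, η₁ ≤ a → g a = 0 := fun a h => hg0 a ((min_le_left _ _).trans h)
  have hg2 : ∀ a, η₂ ≤ a → g a = 0 := fun a h => hg0 a ((min_le_right _ _).trans h)
  -- sup constants of `χ` on `[0, τ] × 𝕋³` and of `g` on `[0, ∞)`
  obtain ⟨Cχ, hCχ⟩ := (isCompact_Icc.prod isCompact_univ :
    IsCompact (Icc (0 : ℝ) τ ×ˢ (univ : Set (UnitAddTorus (Fin 3))))).exists_bound_of_continuousOn hχ.continuousOn
  have hχb : ∀ t ∈ Icc (0 : ℝ) τ, ∀ x, |χ (t, x)| ≤ Cχ := fun t ht x => by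
    simpa only [Real.norm_eq_abs] using hCχ (t, x) ⟨ht, mem_univ _⟩
  obtain ⟨Cg, hCg⟩ := (isCompact_Icc (a := (0 : ℝ)) (b := min η₁ η₂)).exists_bound_of_continuousOn hg.continuousOn
  have hCg0 : 0 ≤ Cg := (norm_nonneg _).trans (hCg 0 ⟨le_rfl, (lt_min hη₁ hη₂).le⟩)
  have hgb : ∀ a, 0 ≤ a → |g a| ≤ Cg := by
    intro a ha0'
    rcases le_or_gt a (min η₁ η₂) with hle | hlt
    · simpa only [Real.norm_eq_abs] using hCg a ⟨ha0', hle⟩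
    · rw [hg0 a hlt.le, abs_zero]; exact hCg0
  have hCχ0 : 0 ≤ Cχ := (abs_nonneg _).trans (hχb 0 ⟨le_rfl, hτ.le⟩ 0)
  have hCC : 0 ≤ Cχ * Cg := mul_nonneg hCχ0 hCg0
  -- accuracies (those of `h3`, `h4` are chosen after `L`)
  have hη4 : 0 < η / 4 := by positivity
  have hδ4 : 0 < δ / 4 := by positivity
  have hη2 : 0 < η / (4 * (Cχ * Cg + 1)) := by positivity
  obtain ⟨r₁, hr₁, H1⟩ := H1 σ hσ hσ₁' Φ τ hτ χ hχ g hg hg1 (η / 4) (δ / 4) hη4 hδ4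
  obtain ⟨r₂, hr₂, H2⟩ := H2 σ hσ hσ₂' Φ τ hτ χ hχ g hg hg2 (η / (4 * (Cχ * Cg + 1))) (δ / 4) hη2 hδ4
  refine ⟨min r₁ r₂, lt_min hr₁ hr₂, ?_⟩
  intro r hr hrlt L hL
  have hL0 : 0 < L := one_pos.trans_le hL
  have hr1 : r < r₁ := lt_of_lt_of_le hrlt (min_le_left _ _)
  have hr2 : r < r₂ := lt_of_lt_of_le hrlt (min_le_right _ _)
  have hη3 : 0 < η / (4 * (2 * (Cχ * Cg * (2 * L)) + 1)) := by positivity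
  have hη4' : 0 < η / (4 * (Cχ * Cg * (2 * L) + 1)) := by positivity
  obtain ⟨κ₁, hκ₁, H1⟩ := H1 r hr hr1 L hL
  obtain ⟨κ₂, hκ₂, H2⟩ := H2 r hr hr2 L hL
  obtain ⟨κ₃, hκ₃, H3⟩ := H3 σ hσ hσ₃' Φ τ hτ (η / (4 * (2 * (Cχ * Cg * (2 * L)) + 1))) (δ / 4) hη3 hδ4 L hL
  obtain ⟨κ₄, hκ₄, H4⟩ := H4 σ hσ hσ₄' Φ τ hτ (η / (4 * (Cχ * Cg * (2 * L) + 1))) (δ / 4) hη4' hδ4 L hL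
  refine ⟨min (min (min κ₁ κ₂) (min κ₃ κ₄)) (1 / (4 * L)),
    lt_min (lt_min (lt_min hκ₁ hκ₂) (lt_min hκ₃ hκ₄)) (by positivity), ?_⟩
  intro κ hκ hκlt
  have hκ' : κ < min (min κ₁ κ₂) (min κ₃ κ₄) := lt_of_lt_of_le hκlt (min_le_left _ _)
  have hκL : κ < 1 / (4 * L) := lt_of_lt_of_le hκlt (min_le_right _ _)
  have hκ₁' : κ < κ₁ := lt_of_lt_of_le hκ' ((min_le_left _ _).trans (min_le_left _ _))
  have hκ₂' : κ < κ₂ := lt_of_lt_of_le hκ' ((min_le_left _ _).trans (min_le_right _ _))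
  have hκ₃' : κ < κ₃ := lt_of_lt_of_le hκ' ((min_le_right _ _).trans (min_le_left _ _))
  have hκ₄' : κ < κ₄ := lt_of_lt_of_le hκ' ((min_le_right _ _).trans (min_le_right _ _))
  obtain ⟨N₁, H1⟩ := H1 κ hκ hκ₁'
  obtain ⟨N₂, H2⟩ := H2 κ hκ hκ₂'
  obtain ⟨N₃, H3⟩ := H3 κ hκ hκ₃'
  obtain ⟨N₄, H4⟩ := H4 κ hκ hκ₄'
  refine ⟨max (max N₁ N₂) (max N₃ N₄), fun N hN k l => ?_⟩
  have hN1 : N₁ ≤ N := ((le_max_left _ _).trans (le_max_left _ _)).trans hN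
  have hN2 : N₂ ≤ N := ((le_max_right _ _).trans (le_max_left _ _)).trans hN
  have hN3 : N₃ ≤ N := ((le_max_left _ _).trans (le_max_right _ _)).trans hN
  have hN4 : N₄ ≤ N := ((le_max_right _ _).trans (le_max_right _ _)).trans hN
  have E1 := H1 N hN1 k l
  have E2 := H2 N hN2 k l
  have E3 := H3 N hN3
  have E4 := H4 N hN4
  -- the minimal-image smallness `ε (1 + 2 L κ) < 1/2`
  have hLκ : 2 * L * κ ≤ 1 / 2 := by
    have : L * κ ≤ L * (1 / (4 * L)) := mul_le_mul_of_nonneg_left hκL.le hL0.le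
    rw [show L * (1 / (4 * L)) = 1 / 4 by field_simp] at this
    linarith
  have hsmall : hsDiameter σ N * (1 + 2 * L * κ) < 1 / 2 := by
    have hε := hsDiameter_le hσ.le N
    have hε0 := (hsDiameter_pos hσ N).le
    nlinarith
  -- the mark
  have hΨc := continuous_evenMarkTrunc k l L
  have hΨb : ∀ p, |evenMarkTrunc k l L p| ≤ 2 * L := abs_evenMarkTrunc_le k l hL0.le
  have hΨ0 : ∀ n v w : V3, 2 * L ≤ ‖w - v‖ → evenMarkTrunc k l L (n, v, w) = 0 :=
    fun n v w h => evenMarkTrunc_eq_zero_of_le k l hL0 h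
  -- the union bound on the good set
  set P := localGibbsLaw σ a₀ u₀ θ₀ N (Φ N) with hP
  set S₁ := {z : Config (N + 1) (Fin 3) T3 | η / 4 <
    ((N + 1 : ℝ) * κ)⁻¹ * continuityCorrection σ N (Φ N) τ χ g (evenMarkTrunc k l L) r κ z} with hS₁
  set S₂ := {z : Config (N + 1) (Fin 3) T3 | η / (4 * (Cχ * Cg + 1)) <
    ((N + 1 : ℝ) * κ)⁻¹ * shortFlightDeficit σ N (Φ N) τ (evenMarkTrunc k l L) κ z} with hS₂
  set S₃ := {z : Config (N + 1) (Fin 3) T3 | η / (4 * (2 * (Cχ * Cg * (2 * L)) + 1)) <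
    hsDiameter σ N / (N + 1 : ℝ) * threeBodyCollisionSum σ N (Φ N) τ L κ z} with hS₃
  set S₄ := {z : Config (N + 1) (Fin 3) T3 | η / (4 * (Cχ * Cg * (2 * L) + 1)) <
    hsDiameter σ N / (N + 1 : ℝ) * pairShellCount σ N L κ ((Φ N).flow τ z)} with hS₄
  set E := {z : Config (N + 1) (Fin 3) T3 | η <
    |collisionSum σ N (Φ N) τ χ g (evenMarkTrunc k l L) r z -
      tubeTimeStat σ N (Φ N) τ χ g (evenMarkTrunc k l L) r r 1 κ z|} with hE
  have hsub : E ∩ (Φ N).good ⊆ ((S₁ ∪ S₂) ∪ S₃) ∪ S₄ := by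
    rintro z ⟨hz, hgood⟩
    by_contra hnot
    simp only [Set.mem_union, not_or, hS₁, hS₂, hS₃, hS₄, Set.mem_setOf_eq, not_lt] at hnot
    obtain ⟨⟨⟨b1, b2⟩, b3⟩, b4⟩ := hnot
    have hpath := cylinderPullback_pathwise σ N (Φ N) τ χ g (evenMarkTrunc k l L) r r κ L Cχ Cg (2 * L) z
      hgood hσ hτ hr hκ hL0.le hsmall hχ hg hΨc hχb hgb hΨb hΨ0
    have hc : 0 ≤ ((N + 1 : ℝ) * κ)⁻¹ := by positivity
    have hεN : 0 ≤ hsDiameter σ N / (N + 1 : ℝ) := by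
      have := (hsDiameter_pos hσ N).le; positivity
    have t2 : ((N + 1 : ℝ) * κ)⁻¹ * (Cχ * Cg * shortFlightDeficit σ N (Φ N) τ (evenMarkTrunc k l L) κ z) ≤ η / 4 := by
      calc ((N + 1 : ℝ) * κ)⁻¹ * (Cχ * Cg * shortFlightDeficit σ N (Φ N) τ (evenMarkTrunc k l L) κ z)
          = Cχ * Cg * (((N + 1 : ℝ) * κ)⁻¹ * shortFlightDeficit σ N (Φ N) τ (evenMarkTrunc k l L) κ z) := by ring
        _ ≤ Cχ * Cg * (η / (4 * (Cχ * Cg + 1))) := mul_le_mul_of_nonneg_left b2 hCC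
        _ ≤ η / 4 := mul_eta_div_le hCC hη.le
    have t3 : Cχ * Cg * (2 * L) * (hsDiameter σ N / (N + 1 : ℝ)) *
        (2 * threeBodyCollisionSum σ N (Φ N) τ L κ z) ≤ η / 4 := by
      calc Cχ * Cg * (2 * L) * (hsDiameter σ N / (N + 1 : ℝ)) * (2 * threeBodyCollisionSum σ N (Φ N) τ L κ z)
          = 2 * (Cχ * Cg * (2 * L)) * (hsDiameter σ N / (N + 1 : ℝ) * threeBodyCollisionSum σ N (Φ N) τ L κ z) := by
            ring
        _ ≤ 2 * (Cχ * Cg * (2 * L)) * (η / (4 * (2 * (Cχ * Cg * (2 * L)) + 1))) :=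
            mul_le_mul_of_nonneg_left b3 (by positivity)
        _ ≤ η / 4 := mul_eta_div_le (by positivity) hη.le
    have t4 : Cχ * Cg * (2 * L) * (hsDiameter σ N / (N + 1 : ℝ)) * pairShellCount σ N L κ ((Φ N).flow τ z) ≤ η / 4 := by
      calc Cχ * Cg * (2 * L) * (hsDiameter σ N / (N + 1 : ℝ)) * pairShellCount σ N L κ ((Φ N).flow τ z)
          = Cχ * Cg * (2 * L) * (hsDiameter σ N / (N + 1 : ℝ) * pairShellCount σ N L κ ((Φ N).flow τ z)) := by ring
        _ ≤ Cχ * Cg * (2 * L) * (η / (4 * (Cχ * Cg * (2 * L) + 1))) := mul_le_mul_of_nonneg_left b4 (by positivity)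
        _ ≤ η / 4 := mul_eta_div_le (by positivity) hη.le
    have hle : |collisionSum σ N (Φ N) τ χ g (evenMarkTrunc k l L) r z -
        tubeTimeStat σ N (Φ N) τ χ g (evenMarkTrunc k l L) r r 1 κ z| ≤ η := by
      refine hpath.trans ?_
      rw [mul_add, mul_add]
      linarith
    exact (not_lt.2 hle) hz
  have hgoodc : P (Φ N).goodᶜ = 0 := localGibbsLaw_goodCompl (Φ N)
  calc P E = P (E ∩ (Φ N).good ∪ E \ (Φ N).good) := by rw [Set.inter_union_sdiff]
    _ ≤ P (E ∩ (Φ N).good) + P (E \ (Φ N).good) := measure_union_le _ _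
    _ ≤ P (((S₁ ∪ S₂) ∪ S₃) ∪ S₄) + 0 := by
        refine add_le_add (measure_mono hsub) ?_
        exact (measure_mono fun z hz => hz.2).trans hgoodc.le
    _ ≤ P S₁ + P S₂ + P S₃ + P S₄ := by
        rw [add_zero]
        exact (measure_union_le _ _).trans (add_le_add ((measure_union_le _ _).trans
          (add_le_add (measure_union_le _ _) le_rfl)) le_rfl)
    _ ≤ ENNReal.ofReal (δ / 4) + ENNReal.ofReal (δ / 4) + ENNReal.ofReal (δ / 4) + ENNReal.ofReal (δ / 4) :=
        add_le_add (add_le_add (add_le_add E1 E2) E3) E4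
    _ = ENNReal.ofReal δ := by
        rw [← ENNReal.ofReal_add hδ4.le hδ4.le, ← ENNReal.ofReal_add (by positivity) hδ4.le,
          ← ENNReal.ofReal_add (by positivity) hδ4.le]
        congr 1
        ring


end Summit.AtomisticToContinuum.HydrodynamicLimit.Theorems.EvenStressEnskog

end
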